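import Mathlib
import Summits.RiemannHypothesis.RiemannHypothesis.Theorems.SoloBlindSinglePairVisible

/-!
# SoloBlind artefact 19 — the single pair on the critical lattice is INVISIBLE when `∫_{-a}^{a} sinh²(δx) dx ≤ a`

Context (soloist `solo-RiemannHypothesis-blind`, report `paper/window-height.md` §12.5 / §12.8, claim C63).  Converse of
artefact 18: on the critical lattice `2π/s = 2a` (the frame of Theorem D1 is an orthogonal basis of `L²` of the window) the
configuration `Z({0}, δ)` — on-line zeros `js` (`j ≠ 0`), one pair `∓iδ` at the site `0` — satisfies, for EVERY `g ∈ L²((-a,a])`,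
`Q(g) = Σ_{j≠0}|H(js)|² + 2Re[H(-iδ) conj H(iδ)] ≥ 0` as soon as `L := ∫_{-a}^{a} sinh²(δx) dx ≤ a`
(`soloBlind_singlePair_invisible`; with artefact 18 this is the exact single-pair constant: visible iff `sinh(2δa) > 4δa`,
i.e. `δa > 1.0887…`, `soloBlind_singlePair_invisible_of_sinh`).

Proof (phase-aware, beyond the Gram-matrix method of artefacts 16–17): `2Re[H(-iδ) conj H(iδ)] = 2|C|² - 2|S|²` with
`S = ∫ g sinh(δ·)`; the POLARISED Theorem D1 (`soloBlind_lattice_inner_hasSum`, Plancherel in inner-product form on the critical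
lattice) gives `2a·S = Σ_j H(js) conj Φ_j` with `Φ_j` the lattice transform of `sinh(δ·)𝟙`, and `Φ_0 = ∫ sinh = 0` (odd); hence by
Cauchy–Schwarz (`soloBlind_tsum_cs`) `4a²|S|² ≤ (Σ_{j≠0}|H(js)|²)·(2aL)`, i.e. `2|S|² ≤ (L/a)·Σ_{j≠0}|H(js)|² ≤ Σ_{j≠0}|H(js)|²`.
Mathlib + artefacts 13/16/18 only; no sorries.
-/

open MeasureTheory Complex Set
open scoped Real ComplexConjugate

namespace Summit.RiemannHypothesis.RiemannHypothesis.Theorems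

/-- Complex polarisation: `4 z conj(w) = (|z+w|² - |z-w|²) + i(|z+iw|² - |z-iw|²)`. -/
theorem soloBlind_polC (z w : ℂ) :
    4 * (z * conj w) = (((‖z + 1 * w‖ ^ 2 - ‖z + (-1) * w‖ ^ 2 : ℝ)) : ℂ)
      + I * (((‖z + I * w‖ ^ 2 - ‖z + (-I) * w‖ ^ 2 : ℝ)) : ℂ) := by
  apply Complex.ext
  · simp only [Complex.sq_norm, Complex.normSq_apply, Complex.mul_re, Complex.mul_im, Complex.add_re,
      Complex.add_im, Complex.conj_re, Complex.conj_im, Complex.I_re, Complex.I_im,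
      Complex.ofReal_re, Complex.ofReal_im, Complex.neg_re, Complex.neg_im, Complex.one_re, Complex.one_im,
      Complex.re_ofNat, Complex.im_ofNat]
    ring
  · simp only [Complex.sq_norm, Complex.normSq_apply, Complex.mul_re, Complex.mul_im, Complex.add_re,
      Complex.add_im, Complex.conj_re, Complex.conj_im, Complex.I_re, Complex.I_im,
      Complex.ofReal_re, Complex.ofReal_im, Complex.neg_re, Complex.neg_im, Complex.one_re, Complex.one_im,
      Complex.re_ofNat, Complex.im_ofNat]
    ring

/-- Cauchy–Schwarz for `Σ u_j conj(v_j)` from the two square sums. -/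
theorem soloBlind_tsum_cs {u v : ℤ → ℂ} {U V : ℝ} (hu : HasSum (fun j => ‖u j‖ ^ 2) U)
    (hv : HasSum (fun j => ‖v j‖ ^ 2) V) :
    ‖∑' j, u j * conj (v j)‖ ^ 2 ≤ U * V := by
  have hU0 : 0 ≤ U := hu.nonneg fun j => by positivity
  have hV0 : 0 ≤ V := hv.nonneg fun j => by positivity
  have hus : Summable fun j => ‖u j‖ ^ (2 : ℝ) := by simpa [Real.rpow_two] using hu.summable
  have hvs : Summable fun j => ‖v j‖ ^ (2 : ℝ) := by simpa [Real.rpow_two] using hv.summable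
  obtain ⟨hsum, hle⟩ := Real.summable_and_inner_le_Lp_mul_Lq_tsum_of_nonneg Real.HolderConjugate.two_two
    (f := fun j => ‖u j‖) (g := fun j => ‖v j‖) (fun j => norm_nonneg _) (fun j => norm_nonneg _) hus hvs
  have htu : (∑' j, ‖u j‖ ^ (2 : ℝ)) = U := by simp [hu.tsum_eq]
  have htv : (∑' j, ‖v j‖ ^ (2 : ℝ)) = V := by simp [hv.tsum_eq]
  rw [htu, htv, ← Real.sqrt_eq_rpow, ← Real.sqrt_eq_rpow] at hle
  have hnorm : (fun j => ‖u j * conj (v j)‖) = fun j => ‖u j‖ * ‖v j‖ := by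
    funext j; rw [norm_mul, Complex.norm_conj]
  have h1 : ‖∑' j, u j * conj (v j)‖ ≤ ∑' j, ‖u j‖ * ‖v j‖ := by
    calc ‖∑' j, u j * conj (v j)‖ ≤ ∑' j, ‖u j * conj (v j)‖ :=
          norm_tsum_le_tsum_norm (by rw [hnorm]; exact hsum)
      _ = ∑' j, ‖u j‖ * ‖v j‖ := by rw [hnorm]
  have h2 : ‖∑' j, u j * conj (v j)‖ ≤ Real.sqrt U * Real.sqrt V := h1.trans hle
  calc ‖∑' j, u j * conj (v j)‖ ^ 2 ≤ (Real.sqrt U * Real.sqrt V) ^ 2 :=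
        pow_le_pow_left₀ (norm_nonneg _) h2 2
    _ = U * V := by rw [mul_pow, Real.sq_sqrt hU0, Real.sq_sqrt hV0]

/-- **Polarised Theorem D1** (Plancherel in inner-product form): for `G, F ∈ L²` supported in one period
`(c, c + 2π/s]`, `Σ_j Ĝ(u_j) conj F̂(u_j) = (2π/s) ∫ G conj(F)`. -/
theorem soloBlind_lattice_inner_hasSum (c s u₀ : ℝ) (hs : 0 < s) {G F : ℝ → ℂ}
    (hG : MemLp G 2 volume) (hF : MemLp F 2 volume)
    (hsG : Function.support G ⊆ Ioc c (c + 2 * π / s)) (hsF : Function.support F ⊆ Ioc c (c + 2 * π / s)) :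
    HasSum (fun j : ℤ => (∫ x : ℝ, G x * cexp (I * (((u₀ + j * s : ℝ) : ℂ)) * (x : ℂ))) *
        conj (∫ x : ℝ, F x * cexp (I * (((u₀ + j * s : ℝ) : ℂ)) * (x : ℂ))))
      (((2 * π / s : ℝ) : ℂ) * ∫ x : ℝ, G x * conj (F x)) := by
  set T : ℝ := 2 * π / s with hT
  have hvol : volume (Ioc c (c + T)) ≠ ⊤ := by
    rw [Real.volume_Ioc]; exact ENNReal.ofReal_ne_top
  have hzero : ∀ {K : ℝ → ℂ}, Function.support K ⊆ Ioc c (c + T) → ∀ x ∉ Ioc c (c + T), K x = 0 := by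
    intro K hK x hx
    by_contra h
    exact hx (hK (Function.mem_support.mpr h))
  have hG1 : Integrable G := memLp_one_iff_integrable.mp
    (hG.mono_exponent_of_measure_support_ne_top (hzero hsG) hvol (by norm_num))
  have hF1 : Integrable F := memLp_one_iff_integrable.mp
    (hF.mono_exponent_of_measure_support_ne_top (hzero hsF) hvol (by norm_num))
  -- the lattice transforms
  set z : ℤ → ℂ := fun j => ∫ x : ℝ, G x * cexp (I * (((u₀ + j * s : ℝ) : ℂ)) * (x : ℂ)) with hz
  set w : ℤ → ℂ := fun j => ∫ x : ℝ, F x * cexp (I * (((u₀ + j * s : ℝ) : ℂ)) * (x : ℂ)) with hw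
  -- combinations G + c₁ F
  have hK : ∀ c₁ : ℂ, MemLp (fun x => G x + c₁ * F x) 2 volume := fun c₁ => hG.add (hF.const_mul c₁)
  have hKs : ∀ c₁ : ℂ, Function.support (fun x => G x + c₁ * F x) ⊆ Ioc c (c + T) := by
    intro c₁ x hx
    by_contra h
    have h1 : G x = 0 := hzero hsG x h
    have h2 : F x = 0 := hzero hsF x h
    simp [h1, h2] at hx
  have hlin : ∀ (c₁ : ℂ) (j : ℤ),
      (∫ x : ℝ, (G x + c₁ * F x) * cexp (I * (((u₀ + j * s : ℝ) : ℂ)) * (x : ℂ))) = z j + c₁ * w j := by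
    intro c₁ j
    have hGe := soloBlind_integrable_mul_cexp hG1 (u₀ + j * s)
    have hFe := soloBlind_integrable_mul_cexp hF1 (u₀ + j * s)
    simp only [hz, hw]
    rw [← integral_const_mul, ← integral_add hGe (hFe.const_mul c₁)]
    congr 1; funext x; ring
  -- the four norm sums
  have hN : ∀ c₁ : ℂ, HasSum (fun j : ℤ => ‖z j + c₁ * w j‖ ^ 2) (T * ∫ x : ℝ, ‖G x + c₁ * F x‖ ^ 2) := by
    intro c₁
    have h := soloBlind_lattice_normSq_hasSum c s u₀ hs (hK c₁) (hKs c₁)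
    simp only [hlin] at h
    exact h
  -- integrability of the squared norms
  have hNi : ∀ c₁ : ℂ, Integrable (fun x => ‖G x + c₁ * F x‖ ^ 2) := fun c₁ =>
    (memLp_two_iff_integrable_sq_norm (hK c₁).1).mp (hK c₁)
  -- combine
  have hcomb : HasSum (fun j : ℤ => (((‖z j + 1 * w j‖ ^ 2 - ‖z j + (-1) * w j‖ ^ 2 : ℝ)) : ℂ)
        + I * (((‖z j + I * w j‖ ^ 2 - ‖z j + (-I) * w j‖ ^ 2 : ℝ)) : ℂ))
      ((((T * ∫ x : ℝ, ‖G x + 1 * F x‖ ^ 2) - (T * ∫ x : ℝ, ‖G x + (-1) * F x‖ ^ 2) : ℝ) : ℂ)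
        + I * ((((T * ∫ x : ℝ, ‖G x + I * F x‖ ^ 2) - (T * ∫ x : ℝ, ‖G x + (-I) * F x‖ ^ 2) : ℝ)) : ℂ)) :=
    (Complex.hasSum_ofReal.mpr ((hN 1).sub (hN (-1)))).add
      ((Complex.hasSum_ofReal.mpr ((hN I).sub (hN (-I)))).mul_left I)
  have hval : (∫ x : ℝ, G x * conj (F x)) = (1 / 4 : ℂ) *
      ((((∫ x : ℝ, ‖G x + 1 * F x‖ ^ 2) - (∫ x : ℝ, ‖G x + (-1) * F x‖ ^ 2) : ℝ) : ℂ)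
        + I * ((((∫ x : ℝ, ‖G x + I * F x‖ ^ 2) - (∫ x : ℝ, ‖G x + (-I) * F x‖ ^ 2) : ℝ)) : ℂ)) := by
    have hpt : (fun x => G x * conj (F x)) = fun x => (1 / 4 : ℂ) *
        ((((‖G x + 1 * F x‖ ^ 2 - ‖G x + (-1) * F x‖ ^ 2 : ℝ)) : ℂ)
          + I * (((‖G x + I * F x‖ ^ 2 - ‖G x + (-I) * F x‖ ^ 2 : ℝ)) : ℂ)) := by
      funext x
      rw [← soloBlind_polC (G x) (F x)]; ring
    rw [hpt, integral_const_mul]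
    congr 1
    have i1 : Integrable (fun x => (((‖G x + 1 * F x‖ ^ 2 - ‖G x + (-1) * F x‖ ^ 2 : ℝ)) : ℂ)) :=
      ((hNi 1).sub (hNi (-1))).ofReal
    have i2 : Integrable (fun x => I * (((‖G x + I * F x‖ ^ 2 - ‖G x + (-I) * F x‖ ^ 2 : ℝ)) : ℂ)) :=
      (((hNi I).sub (hNi (-I))).ofReal).const_mul I
    rw [integral_add i1 i2, integral_const_mul, integral_complex_ofReal, integral_complex_ofReal,
      integral_sub (hNi 1) (hNi (-1)), integral_sub (hNi I) (hNi (-I))]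
  have hfin := hcomb.mul_left (1 / 4 : ℂ)
  have hfun : (fun j : ℤ => (1 / 4 : ℂ) * ((((‖z j + 1 * w j‖ ^ 2 - ‖z j + (-1) * w j‖ ^ 2 : ℝ)) : ℂ)
        + I * (((‖z j + I * w j‖ ^ 2 - ‖z j + (-I) * w j‖ ^ 2 : ℝ)) : ℂ))) = fun j => z j * conj (w j) := by
    funext j
    rw [← soloBlind_polC]; ring
  have hv : (1 / 4 : ℂ) * ((((T * ∫ x : ℝ, ‖G x + 1 * F x‖ ^ 2) - (T * ∫ x : ℝ, ‖G x + (-1) * F x‖ ^ 2) : ℝ) : ℂ)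
        + I * ((((T * ∫ x : ℝ, ‖G x + I * F x‖ ^ 2) - (T * ∫ x : ℝ, ‖G x + (-I) * F x‖ ^ 2) : ℝ)) : ℂ))
      = ((T : ℝ) : ℂ) * ∫ x : ℝ, G x * conj (F x) := by
    rw [hval]; push_cast; ring
  rw [hfun, hv] at hfin
  exact hfin

/-- **The single pair on the critical lattice is invisible when `∫_{-a}^{a} sinh²(δx) dx ≤ a`.**
Sites `u_j = js` with `2π/s = 2a`; one pair of depth `δ ≥ 0` at `j = 0`; every `g ∈ L²` supported in `(-a, a]`
gives a nonnegative functional. -/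
theorem soloBlind_singlePair_invisible (s a δ : ℝ) (hs : 0 < s) (ha : 0 < a) (hcrit : 2 * π / s = 2 * a)
    (hδ : 0 ≤ δ) (hinv : ∫ x in -a..a, Real.sinh (δ * x) ^ 2 ≤ a)
    {g : ℝ → ℂ} (hg : MemLp g 2 volume) (hsupp : Function.support g ⊆ Ioc (-a) a) :
    0 ≤ ∑' j : ℤ, (if j = 0 then
        2 * ((∫ x : ℝ, g x * cexp (I * ((((0:ℝ) + j * s : ℝ) : ℂ) - I * δ) * (x : ℂ))) *
            conj ((∫ x : ℝ, g x * cexp (I * ((((0:ℝ) + j * s : ℝ) : ℂ) + I * δ) * (x : ℂ))))).re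
      else ‖(∫ x : ℝ, g x * cexp (I * ((((0:ℝ) + j * s : ℝ) : ℂ)) * (x : ℂ)))‖ ^ 2) := by
  have haa : -a ≤ a := by linarith
  set L : ℝ := ∫ x in -a..a, Real.sinh (δ * x) ^ 2 with hL
  -- the auxiliary function φ = sinh(δ·)𝟙
  set φ : ℝ → ℂ := Set.indicator (Ioc (-a) a) (fun x => ((Real.sinh (δ * x) : ℝ) : ℂ)) with hφdef
  have hcs : Continuous fun x : ℝ => ((Real.sinh (δ * x) : ℝ) : ℂ) :=
    Complex.continuous_ofReal.comp (Real.continuous_sinh.comp (continuous_const.mul continuous_id))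
  have hφsupp : Function.support φ ⊆ Ioc (-a) a := Set.support_indicator_subset
  have hφmeas : AEStronglyMeasurable φ volume := hcs.aestronglyMeasurable.indicator measurableSet_Ioc
  have hφnorm : (fun x => ‖φ x‖ ^ 2) = Set.indicator (Ioc (-a) a) (fun x => Real.sinh (δ * x) ^ 2) := by
    funext x
    by_cases hx : x ∈ Ioc (-a) a
    · simp only [hφdef, Set.indicator_of_mem hx, Complex.norm_real, Real.norm_eq_abs, sq_abs]
    · simp [hφdef, Set.indicator_of_notMem hx]
  have hφint_sq : Integrable (fun x => ‖φ x‖ ^ 2) := by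
    rw [hφnorm, integrable_indicator_iff measurableSet_Ioc]
    exact (((Real.continuous_sinh.comp (continuous_const.mul continuous_id)).pow 2).continuousOn.integrableOn_Icc
      (a := -a) (b := a)).mono_set Ioc_subset_Icc_self
  have hφ : MemLp φ 2 volume := (memLp_two_iff_integrable_sq_norm hφmeas).mpr hφint_sq
  have hφI : (∫ x : ℝ, ‖φ x‖ ^ 2) = L := by
    rw [hφnorm, integral_indicator measurableSet_Ioc, ← intervalIntegral.integral_of_le haa]
  have hL0 : 0 ≤ L := by rw [← hφI]; positivity
  -- supports inside one period of the critical lattice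
  have hper : Ioc (-a) (-a + 2 * π / s) = Ioc (-a) a := by rw [hcrit, show -a + 2 * a = a by ring]
  have hsuppT : Function.support g ⊆ Ioc (-a) (-a + 2 * π / s) := by rw [hper]; exact hsupp
  have hφsuppT : Function.support φ ⊆ Ioc (-a) (-a + 2 * π / s) := by rw [hper]; exact hφsupp
  -- D1 for g and φ, polarised D1 for (g, φ)
  have hH := soloBlind_lattice_normSq_hasSum (-a) s 0 hs hg hsuppT
  have hΦ := soloBlind_lattice_normSq_hasSum (-a) s 0 hs hφ hφsuppT
  have hGF := soloBlind_lattice_inner_hasSum (-a) s 0 hs hg hφ hsuppT hφsuppT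
  rw [hcrit] at hH hΦ hGF
  rw [hφI] at hΦ
  -- abbreviations
  set Hh : ℤ → ℂ := fun j => ∫ x : ℝ, g x * cexp (I * ((((0:ℝ) + j * s : ℝ) : ℂ)) * (x : ℂ)) with hHh
  set Φh : ℤ → ℂ := fun j => ∫ x : ℝ, φ x * cexp (I * ((((0:ℝ) + j * s : ℝ) : ℂ)) * (x : ℂ)) with hΦh
  set Hm : ℂ := ∫ x : ℝ, g x * cexp (I * ((((0:ℝ) + (0:ℤ) * s : ℝ) : ℂ) - I * δ) * (x : ℂ)) with hHm
  set Hp : ℂ := ∫ x : ℝ, g x * cexp (I * ((((0:ℝ) + (0:ℤ) * s : ℝ) : ℂ) + I * δ) * (x : ℂ)) with hHp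
  set C0 : ℂ := (Hm + Hp) / 2 with hC0
  set S0 : ℂ := (Hm - Hp) / 2 with hS0
  have hHmCS : Hm = C0 + S0 := by simp only [hC0, hS0]; ring
  have hHpCS : Hp = C0 - S0 := by simp only [hC0, hS0]; ring
  have hpair : 2 * (Hm * conj Hp).re = 2 * ‖C0‖ ^ 2 - 2 * ‖S0‖ ^ 2 := by
    rw [hHmCS, hHpCS]; exact soloBlind_pairTerm_re C0 S0
  -- the series as D1 with the site-0 term replaced
  have hF : HasSum (fun j : ℤ => (if j = 0 then
        2 * ((∫ x : ℝ, g x * cexp (I * ((((0:ℝ) + j * s : ℝ) : ℂ) - I * δ) * (x : ℂ))) *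
            conj ((∫ x : ℝ, g x * cexp (I * ((((0:ℝ) + j * s : ℝ) : ℂ) + I * δ) * (x : ℂ))))).re
      else ‖(∫ x : ℝ, g x * cexp (I * ((((0:ℝ) + j * s : ℝ) : ℂ)) * (x : ℂ)))‖ ^ 2))
      (2 * a * (∫ x : ℝ, ‖g x‖ ^ 2) + (2 * (Hm * conj Hp).re - ‖Hh 0‖ ^ 2)) := by
    have h2 := hasSum_ite_eq (0 : ℤ) (2 * (Hm * conj Hp).re - ‖Hh 0‖ ^ 2)
    convert hH.add h2 using 1
    funext j
    split_ifs with hj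
    · subst hj; simp only [hHm, hHp, hHh]; ring
    · ring
  rw [hF.tsum_eq, hpair]
  -- g is integrable; Hm, Hp as integrals against real exponentials; S0 = ∫ g sinh
  have hvol : volume (Ioc (-a) a) ≠ ⊤ := by rw [Real.volume_Ioc]; exact ENNReal.ofReal_ne_top
  have hg1 : Integrable g := memLp_one_iff_integrable.mp
    (hg.mono_exponent_of_measure_support_ne_top
      (fun x hx => by by_contra h; exact hx (hsupp (Function.mem_support.mpr h))) hvol (by norm_num))
  have hWp : ∀ x ∈ Icc (-a) a, |Real.exp (δ * x)| ≤ Real.exp (δ * a) := by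
    intro x hx
    rw [abs_of_pos (Real.exp_pos _)]
    exact Real.exp_le_exp.mpr (by nlinarith [hx.2])
  have hWm : ∀ x ∈ Icc (-a) a, |Real.exp (-(δ * x))| ≤ Real.exp (δ * a) := by
    intro x hx
    rw [abs_of_pos (Real.exp_pos _)]
    exact Real.exp_le_exp.mpr (by nlinarith [hx.1])
  have hIp : Integrable (fun x => g x * ((Real.exp (δ * x) : ℝ) : ℂ)) :=
    soloBlind_integrable_mul_weight hg1 hsupp (Real.continuous_exp.comp (continuous_const.mul continuous_id))
      _ hWp
  have hIm : Integrable (fun x => g x * ((Real.exp (-(δ * x)) : ℝ) : ℂ)) :=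
    soloBlind_integrable_mul_weight hg1 hsupp (by fun_prop : Continuous fun x : ℝ => Real.exp (-(δ * x))) _ hWm
  have hHm' : Hm = ∫ x : ℝ, g x * ((Real.exp (δ * x) : ℝ) : ℂ) := by
    simp only [hHm]; congr 1; funext x; congr 1
    rw [Complex.ofReal_exp]; congr 1; push_cast
    linear_combination (-(δ : ℂ) * (x : ℂ)) * Complex.I_mul_I
  have hHp' : Hp = ∫ x : ℝ, g x * ((Real.exp (-(δ * x)) : ℝ) : ℂ) := by
    simp only [hHp]; congr 1; funext x; congr 1
    rw [Complex.ofReal_exp]; congr 1; push_cast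
    linear_combination ((δ : ℂ) * (x : ℂ)) * Complex.I_mul_I
  have hS0int : S0 = ∫ x : ℝ, g x * ((Real.sinh (δ * x) : ℝ) : ℂ) := by
    simp only [hS0]; rw [hHm', hHp', ← integral_sub hIp hIm, ← integral_div]
    congr 1; funext x
    rw [Real.sinh_eq]; push_cast; ring
  have hS0conj : S0 = ∫ x : ℝ, g x * conj (φ x) := by
    rw [hS0int]; congr 1; funext x
    by_cases hx : x ∈ Ioc (-a) a
    · simp only [hφdef, Set.indicator_of_mem hx, Complex.conj_ofReal]
    · have : g x = 0 := by
        by_contra h; exact hx (hsupp (Function.mem_support.mpr h))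
      simp [this]
  -- Φ̂_0 = 0 (odd integrand)
  have hΦ0 : Φh 0 = 0 := by
    have h1 : Φh 0 = ∫ x : ℝ, φ x := by
      simp only [hΦh]; congr 1; funext x; simp
    have h2 : (fun x => φ x) = Set.indicator (Ioc (-a) a) (fun x => ((Real.sinh (δ * x) : ℝ) : ℂ)) := by
      funext x; simp [hφdef]
    rw [h1, h2, integral_indicator measurableSet_Ioc, ← intervalIntegral.integral_of_le haa,
      intervalIntegral.integral_ofReal]
    have : ∫ x in -a..a, Real.sinh (δ * x) = 0 := by
      apply soloBlind_intervalIntegral_odd_eq_zero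
      intro x; rw [show δ * -x = -(δ * x) by ring, Real.sinh_neg]
    rw [this]; simp
  -- Cauchy–Schwarz with the site 0 removed
  set u : ℤ → ℂ := fun j => if j = 0 then 0 else Hh j with hu
  have hU : HasSum (fun j => ‖u j‖ ^ 2) (2 * a * (∫ x : ℝ, ‖g x‖ ^ 2) - ‖Hh 0‖ ^ 2) := by
    have h2 := hasSum_ite_eq (0 : ℤ) (-(‖Hh 0‖ ^ 2))
    convert hH.add h2 using 1
    · funext j
      simp only [hu]
      split_ifs with hj
      · subst hj; simp only [hHh]; simp
      · simp only [hHh, add_zero]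
    · ring
  have hsum_eq : (∑' j, u j * conj (Φh j)) = ((2 * a : ℝ) : ℂ) * S0 := by
    have hfun : (fun j => u j * conj (Φh j)) = fun j => Hh j * conj (Φh j) := by
      funext j
      simp only [hu]
      split_ifs with hj
      · subst hj; rw [hΦ0]; simp
      · rfl
    rw [hfun, hGF.tsum_eq, hS0conj]
  have hCS := soloBlind_tsum_cs hU hΦ
  rw [hsum_eq, norm_mul, Complex.norm_real, Real.norm_eq_abs, abs_of_pos (by linarith), mul_pow] at hCS
  -- bookkeeping
  set R : ℝ := 2 * a * (∫ x : ℝ, ‖g x‖ ^ 2) - ‖Hh 0‖ ^ 2 with hR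
  have hR0 : 0 ≤ R := hU.nonneg fun j => by positivity
  have hkey : 2 * ‖S0‖ ^ 2 ≤ R := by
    -- from (2a)²|S0|² ≤ R · (2a L) and L ≤ a
    have h1 : 2 * a * ‖S0‖ ^ 2 ≤ R * L := by nlinarith [hCS, ha]
    have h2 : R * L ≤ R * a := mul_le_mul_of_nonneg_left hinv hR0
    nlinarith [h1, h2, ha, norm_nonneg S0]
  have hC0 : 0 ≤ ‖C0‖ ^ 2 := by positivity
  have : 2 * a * (∫ x : ℝ, ‖g x‖ ^ 2) + (2 * ‖C0‖ ^ 2 - 2 * ‖S0‖ ^ 2 - ‖Hh 0‖ ^ 2)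
      = R + 2 * ‖C0‖ ^ 2 - 2 * ‖S0‖ ^ 2 := by simp only [hR]; ring
  rw [this]
  linarith

/-- **Corollary (closed form of the converse).**  With `2π/s = 2a`, `0 < δ` and `sinh(2δa) ≤ 4δa` (i.e. `δa ≤ 1.0887…`)
the single pair at depth `δ` on the critical lattice is invisible to every admissible test function. -/
theorem soloBlind_singlePair_invisible_of_sinh (s a δ : ℝ) (hs : 0 < s) (ha : 0 < a) (hcrit : 2 * π / s = 2 * a)
    (hδ : 0 < δ) (hinv : Real.sinh (2 * δ * a) ≤ 4 * δ * a)
    {g : ℝ → ℂ} (hg : MemLp g 2 volume) (hsupp : Function.support g ⊆ Ioc (-a) a) :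
    0 ≤ ∑' j : ℤ, (if j = 0 then
        2 * ((∫ x : ℝ, g x * cexp (I * ((((0:ℝ) + j * s : ℝ) : ℂ) - I * δ) * (x : ℂ))) *
            conj ((∫ x : ℝ, g x * cexp (I * ((((0:ℝ) + j * s : ℝ) : ℂ) + I * δ) * (x : ℂ))))).re
      else ‖(∫ x : ℝ, g x * cexp (I * ((((0:ℝ) + j * s : ℝ) : ℂ)) * (x : ℂ)))‖ ^ 2) := by
  apply soloBlind_singlePair_invisible s a δ hs ha hcrit hδ.le _ hg hsupp
  rw [soloBlind_integral_sinh_sq a δ (ne_of_gt hδ), sub_le_iff_le_add, div_le_iff₀ (by positivity)]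
  linarith

end Summit.RiemannHypothesis.RiemannHypothesis.Theorems
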